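import Summits.CriticalPhenomena.CardyFormulaZ2.Theorems.CardyComplexConeEdgePrecompactUFRSStrandsArms

/-!
# Three strands of one completion ⇒ half-plane arms, III: the exterior region is connected
(line `qkz-strip-boundary-arm` of crux `CardyComplexCone.EdgePrecompact`, stmt-CriticalPhenomena-11387;
planar input of the registered sub-goal `ufrs_rect_strandsHpArms_pure`, HT-A pure case)

The exterior-set sector lemma `strands_sectorsZ` (`…UFRSStrandsHpArmsPureSectors.lean`) needs a
PRECONNECTED exterior set. For strands through the inner faces of the lattice box of a rectangle
the exterior set is the part of the open annulus `U = (r + 1/2, R - 1/2)` about `z` beyond one of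
the four sides of the shrunk box (`exteriorSet`, `…UFRSStrandsHpArmsPureGeometry.lean`). This file
proves that it is preconnected (`annulus_exterior_preconnected`, registered anchor
`ufrs_annulusExteriorPreconnected`) under the "adaptivity" hypothesis that every side met by `U` is
in fact within a third of the outer radius of `z` (and opposite sides are `≥ 2R` apart): then

* each piece `U ∩ {half-plane}` is preconnected (`annulus_inter_halfPlane_preconnected`: slide a
  point along its circle about `z` towards the half-plane — the linear functional decreases — down
  to the "bottom point" of the circle, and join the bottom points by the radial segment; the
  standard position `{im < h}` is transported to any direction `u` by `w ↦ (I u)⁻¹ w`);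
* two nonempty pieces belong to adjacent sides and share the diagonal point `z + (R'/3)(±1 ± i)`.

References: M. Aizenman, A. Burchard, Duke Math. J. 99 (1999), Appendix A (sectors of an annulus);
G. F. Lawler, O. Schramm, W. Werner, Electron. J. Probab. 7 (2002), Appendix A.
-/

namespace Summit.CriticalPhenomena.CardyFormulaZ2.Cruxes.EdgePrecompact.QkzStripBoundaryArm

open MeasureTheory Filter Set Metric Complex
open scoped Topology BigOperators Pointwise
open Literature.Probability.LatticeModels Literature.Probability.Percolation
open Literature.Probability.RandomPlanarGeometry (DobrushinDomain)
open Summit.CriticalPhenomena.CardyFormulaZ2.Theses.CardyComplexCone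

noncomputable section

/-! ## An annulus cut by a half-plane is connected -/

/-- The arc `t ↦ z - i ρ e^{it}` of the circle of radius `ρ` about `z`: distance `ρ` from `z` and
height `z.im - ρ cos t`. -/
theorem arc_point_HTP (z : ℂ) (ρ t : ℝ) :
    dist (z - I * ρ * exp (t * I)) z = |ρ| ∧ (z - I * ρ * exp (t * I)).im = z.im - ρ * Real.cos t := by
  constructor
  · rw [dist_eq_norm, sub_sub_cancel_left, norm_neg, norm_mul, norm_mul, norm_I, one_mul, norm_real,
      Real.norm_eq_abs, norm_exp_ofReal_mul_I, mul_one]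
  · simp [exp_ofReal_mul_I_re, exp_ofReal_mul_I_im]

/-- **An open annulus cut by the half-plane `{im < h}` is preconnected** (standard position;
possibly empty). Slide each point along its circle about `z` to the bottom point of the circle (the
height does not increase), and join bottom points along the downward radius. -/
theorem annulus_inter_below_preconnected (z : ℂ) (r' R' h : ℝ) (hr' : 0 < r') :
    IsPreconnected {w : ℂ | (r' < dist w z ∧ dist w z < R') ∧ w.im < h} := by
  set S : Set ℂ := {w : ℂ | (r' < dist w z ∧ dist w z < R') ∧ w.im < h} with hS
  -- the downward radius inside `S`
  set D : Set ℂ := (fun t : ℝ => z - I * t) '' {t : ℝ | r' < t ∧ t < R' ∧ z.im - h < t} with hD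
  have hDconv : IsPreconnected D := by
    refine (Convex.isPreconnected ?_).image _ (by fun_prop)
    have e : {t : ℝ | r' < t ∧ t < R' ∧ z.im - h < t} = Ioi r' ∩ Iio R' ∩ Ioi (z.im - h) := by
      ext t; simp only [mem_setOf_eq, mem_inter_iff, mem_Ioi, mem_Iio]; tauto
    rw [e]
    exact ((convex_Ioi _).inter (convex_Iio _)).inter (convex_Ioi _)
  have hDS : D ⊆ S := by
    rintro _ ⟨t, ⟨h1, h2, h3⟩, rfl⟩
    have ht : 0 < t := hr'.trans h1
    have hd : dist (z - I * t) z = t := by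
      rw [dist_eq_norm, sub_sub_cancel_left, norm_neg, norm_mul, norm_I, one_mul, norm_real, Real.norm_eq_abs,
        abs_of_pos ht]
    refine ⟨⟨by rw [hd]; exact h1, by rw [hd]; exact h2⟩, ?_⟩
    show (z - I * t).im < h
    simp; linarith
  -- the arc from a point of `S` to the bottom point of its circle
  have harc : ∀ w ∈ S, ∃ A ⊆ S, IsPreconnected A ∧ w ∈ A ∧ (z - I * dist w z) ∈ A ∧ (z - I * dist w z) ∈ D := by
    rintro w ⟨⟨hw1, hw2⟩, hwh⟩
    set ρ : ℝ := dist w z with hρ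
    have hρ0 : 0 < ρ := hr'.trans hw1
    -- polar parameter
    set v : ℂ := I * (w - z) / ρ with hv
    have hvn : ‖v‖ = 1 := by
      rw [hv, norm_div, norm_mul, norm_I, one_mul, norm_real, Real.norm_eq_abs, abs_of_pos hρ0, ← dist_eq_norm, hρ,
        div_self hρ0.ne']
    set t₀ : ℝ := arg v with ht₀
    have hexp : exp (t₀ * I) = v := by
      have := norm_mul_exp_arg_mul_I v
      rwa [hvn, ofReal_one, one_mul] at this
    have hw_eq : z - I * ρ * exp (t₀ * I) = w := by
      rw [hexp, hv]
      have hρc : (ρ : ℂ) ≠ 0 := ofReal_ne_zero.2 hρ0.ne'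
      field_simp
      ring_nf
      rw [I_sq]; ring
    have hcos₀ : w.im = z.im - ρ * Real.cos t₀ := by
      conv_lhs => rw [← hw_eq]
      exact (arc_point_HTP z ρ t₀).2
    -- the arc over the interval between `0` and `t₀`
    set γ : ℝ → ℂ := fun t => z - I * ρ * exp (t * I) with hγ
    have hγc : Continuous γ := by fun_prop
    refine ⟨γ '' uIcc 0 t₀, ?_, (convex_uIcc 0 t₀).isPreconnected.image γ hγc.continuousOn,
      ⟨t₀, right_mem_uIcc, hw_eq⟩, ⟨0, left_mem_uIcc, by simp [hγ]⟩, ?_⟩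
    · rintro _ ⟨t, ht, rfl⟩
      obtain ⟨hd, him⟩ := arc_point_HTP z ρ t
      refine ⟨⟨by rw [hγ]; dsimp only; rw [hd, abs_of_pos hρ0]; exact hw1,
        by rw [hγ]; dsimp only; rw [hd, abs_of_pos hρ0]; exact hw2⟩, ?_⟩
      show (γ t).im < h
      rw [hγ]; dsimp only; rw [him]
      -- `cos t ≥ cos t₀` since `|t| ≤ |t₀| ≤ π`
      have hπ : |t₀| ≤ Real.pi := abs_le.2 ⟨(neg_pi_lt_arg v).le, arg_le_pi v⟩
      have htt : |t| ≤ |t₀| := by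
        rcases mem_uIcc.1 ht with ⟨h0, h1⟩ | ⟨h0, h1⟩
        · rw [abs_of_nonneg h0, abs_of_nonneg (h0.trans h1)]; exact h1
        · rw [abs_of_nonpos h1, abs_of_nonpos (h0.trans h1)]; linarith
      have hcos : Real.cos t₀ ≤ Real.cos t := by
        rw [← Real.cos_abs t, ← Real.cos_abs t₀]
        exact Real.cos_le_cos_of_nonneg_of_le_pi (abs_nonneg t) hπ htt
      nlinarith
    · refine ⟨ρ, ⟨hw1, hw2, ?_⟩, rfl⟩
      have h1 : Real.cos t₀ ≤ 1 := Real.cos_le_one t₀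
      nlinarith
  -- conclusion
  refine isPreconnected_of_forall_pair fun x hx y hy => ?_
  obtain ⟨Ax, hAxS, hAx, hxA, hbx, hbxD⟩ := harc x hx
  obtain ⟨Ay, hAyS, hAy, hyA, hby, hbyD⟩ := harc y hy
  refine ⟨Ax ∪ D ∪ Ay, union_subset (union_subset hAxS hDS) hAyS, mem_union_left _ (mem_union_left _ hxA),
    mem_union_right _ hyA, ?_⟩
  exact (IsPreconnected.union _ hbx hbxD hAx hDconv).union _ (mem_union_right _ hbyD) hby hAy

/-- **An open annulus cut by any half-plane is preconnected**: for a unit complex number `u`, the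
set `{w : r' < |w - z| < R', re (u w) < h}` is preconnected (transport of the standard position by
`w ↦ (I u) w`, under which `im ((I u) w) = re (u w)`). -/
theorem annulus_inter_halfPlane_preconnected (z u : ℂ) (hu : ‖u‖ = 1) (r' R' h : ℝ) (hr' : 0 < r') :
    IsPreconnected {w : ℂ | (r' < dist w z ∧ dist w z < R') ∧ (u * w).re < h} := by
  have hu0 : u ≠ 0 := fun h0 => by rw [h0, norm_zero] at hu; exact one_ne_zero hu.symm
  have hIu : I * u ≠ 0 := mul_ne_zero I_ne_zero hu0
  have hnIu : ‖I * u‖ = 1 := by rw [norm_mul, norm_I, hu, one_mul]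
  set f : ℂ → ℂ := fun w => (I * u)⁻¹ * w with hf
  have key : {w : ℂ | (r' < dist w z ∧ dist w z < R') ∧ (u * w).re < h} =
      f '' {w : ℂ | (r' < dist w ((I * u) * z) ∧ dist w ((I * u) * z) < R') ∧ w.im < h} := by
    ext w
    simp only [mem_setOf_eq, mem_image, hf]
    constructor
    · rintro ⟨⟨h1, h2⟩, h3⟩
      refine ⟨(I * u) * w, ⟨⟨?_, ?_⟩, ?_⟩, by rw [inv_mul_cancel_left₀ hIu]⟩
      · rwa [dist_eq_norm, ← mul_sub, norm_mul, hnIu, one_mul, ← dist_eq_norm]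
      · rwa [dist_eq_norm, ← mul_sub, norm_mul, hnIu, one_mul, ← dist_eq_norm]
      · have : (I * u * w).im = (u * w).re := by rw [mul_assoc, I_mul_im]
        rwa [this]
    · rintro ⟨w', ⟨⟨h1, h2⟩, h3⟩, rfl⟩
      have e1 : dist ((I * u)⁻¹ * w') z = dist w' (I * u * z) := by
        rw [dist_eq_norm, dist_eq_norm, show (I * u)⁻¹ * w' - z = (I * u)⁻¹ * (w' - I * u * z) by
          rw [mul_sub, inv_mul_cancel_left₀ hIu], norm_mul, norm_inv, hnIu, inv_one, one_mul]
      refine ⟨⟨by rw [e1]; exact h1, by rw [e1]; exact h2⟩, ?_⟩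
      have : (u * ((I * u)⁻¹ * w')).re = w'.im := by
        have e2 : u * ((I * u)⁻¹ * w') = -I * w' := by
          field_simp
          ring_nf
          rw [I_sq]; ring
        rw [e2]; simp
      rwa [this]
  rw [key]
  exact (annulus_inter_below_preconnected _ r' R' h hr').image f (by fun_prop)

/-! ## The exterior of a rectangle inside an annulus -/

/-- Union of two preconnected sets that intersect as soon as both are nonempty. -/
theorem isPreconnected_union_of_HTP {A B : Set ℂ} (hAB : A.Nonempty → B.Nonempty → (A ∩ B).Nonempty)
    (hA : IsPreconnected A) (hB : IsPreconnected B) : IsPreconnected (A ∪ B) := by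
  rcases A.eq_empty_or_nonempty with rfl | hAn
  · rwa [empty_union]
  rcases B.eq_empty_or_nonempty with rfl | hBn
  · rwa [union_empty]
  obtain ⟨x, hxA, hxB⟩ := hAB hAn hBn
  exact hA.union x hxA hxB hB

/-- A point `z + t d` with `t ≤ ‖t d‖ ≤ 2t` lies in the annulus `(r', R')` when `r' < t` and `2 t < R'`. -/
theorem diag_mem_annulus_HTP (z d : ℂ) {t r' R' : ℝ} (ht : 0 ≤ t) (hd1 : 1 ≤ ‖d‖) (hd2 : ‖d‖ ≤ 2)
    (h1 : r' < t) (h2 : 2 * t < R') : r' < dist (z + t * d) z ∧ dist (z + t * d) z < R' := by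
  rw [dist_eq_norm, add_sub_cancel_left, norm_mul, norm_real, Real.norm_eq_abs, abs_of_nonneg ht]
  constructor <;> nlinarith

/-- Norm bounds for the four diagonal directions `±1 ± i`. -/
theorem norm_diag_bounds_HTP (d : ℂ) (hre : d.re = 1 ∨ d.re = -1) (him : d.im = 1 ∨ d.im = -1) :
    1 ≤ ‖d‖ ∧ ‖d‖ ≤ 2 := by
  have hsq : ‖d‖ ^ 2 = 2 := by
    rw [Complex.sq_norm, Complex.normSq_apply]
    rcases hre with h | h <;> rcases him with h' | h' <;> rw [h, h'] <;> norm_num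
  have hn := norm_nonneg d
  constructor <;> nlinarith

/-- **The exterior of the shrunk box inside the annulus is preconnected.** Hypotheses: the inner
radius `r + 1/2` is positive and less than a third of the outer radius `R - 1/2`; opposite sides of
the shrunk box `[a₀ + 1/8, a₁ - 1/8] × [b₀ + 1/8, b₁ - 1/8]` are at least `2 (R - 1/2)` apart; and
every side-line within `R - 1/2` of `z` (on the box side) is within a third of it ("adaptivity").
Then the set of points of the open annulus `(r + 1/2, R - 1/2)` about `z` beyond one of the four
side-lines is preconnected. -/
theorem annulus_exterior_preconnected (z : ℂ) (r R : ℝ) (a₀ a₁ b₀ b₁ : ℤ) (hr : 0 ≤ r)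
    (h3 : 3 * (r + 1 / 2) < R - 1 / 2)
    (hW : 2 * (R - 1 / 2) ≤ ((a₁ : ℝ) - 1 / 8) - ((a₀ : ℝ) + 1 / 8))
    (hH : 2 * (R - 1 / 2) ≤ ((b₁ : ℝ) - 1 / 8) - ((b₀ : ℝ) + 1 / 8))
    (hL : z.re - ((a₀ : ℝ) + 1 / 8) < R - 1 / 2 → z.re - ((a₀ : ℝ) + 1 / 8) < (R - 1 / 2) / 3)
    (hRt : ((a₁ : ℝ) - 1 / 8) - z.re < R - 1 / 2 → ((a₁ : ℝ) - 1 / 8) - z.re < (R - 1 / 2) / 3)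
    (hB : z.im - ((b₀ : ℝ) + 1 / 8) < R - 1 / 2 → z.im - ((b₀ : ℝ) + 1 / 8) < (R - 1 / 2) / 3)
    (hT : ((b₁ : ℝ) - 1 / 8) - z.im < R - 1 / 2 → ((b₁ : ℝ) - 1 / 8) - z.im < (R - 1 / 2) / 3) :
    IsPreconnected {w : ℂ | (r + 1 / 2 < dist w z ∧ dist w z < R - 1 / 2) ∧
      (w.re < (a₀ : ℝ) + 1 / 8 ∨ (a₁ : ℝ) - 1 / 8 < w.re ∨ w.im < (b₀ : ℝ) + 1 / 8 ∨ (b₁ : ℝ) - 1 / 8 < w.im)} := by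
  set r' : ℝ := r + 1 / 2 with hr'
  set R' : ℝ := R - 1 / 2 with hR'
  set α : ℝ := (a₀ : ℝ) + 1 / 8 with hα
  set α' : ℝ := (a₁ : ℝ) - 1 / 8 with hα'
  set β : ℝ := (b₀ : ℝ) + 1 / 8 with hβ
  set β' : ℝ := (b₁ : ℝ) - 1 / 8 with hβ'
  have hr'0 : 0 < r' := by rw [hr']; linarith
  set U : Set ℂ := {w : ℂ | r' < dist w z ∧ dist w z < R'} with hU
  set gL : Set ℂ := {w : ℂ | (r' < dist w z ∧ dist w z < R') ∧ w.re < α} with hgL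
  set gR : Set ℂ := {w : ℂ | (r' < dist w z ∧ dist w z < R') ∧ α' < w.re} with hgR
  set gB : Set ℂ := {w : ℂ | (r' < dist w z ∧ dist w z < R') ∧ w.im < β} with hgB
  set gT : Set ℂ := {w : ℂ | (r' < dist w z ∧ dist w z < R') ∧ β' < w.im} with hgT
  -- the four pieces are preconnected
  have hpL : IsPreconnected gL := by
    have := annulus_inter_halfPlane_preconnected z 1 (by simp) r' R' α hr'0
    simpa only [one_mul] using this
  have hpR : IsPreconnected gR := by
    have := annulus_inter_halfPlane_preconnected z (-1) (by simp) r' R' (-α') hr'0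
    have e : {w : ℂ | (r' < dist w z ∧ dist w z < R') ∧ (-1 * w).re < -α'} = gR := by
      ext w; simp only [mem_setOf_eq, neg_mul, one_mul, neg_re, neg_lt_neg_iff, hgR]
    rwa [e] at this
  have hpB : IsPreconnected gB := by
    have := annulus_inter_halfPlane_preconnected z (-I) (by simp) r' R' β hr'0
    have e : {w : ℂ | (r' < dist w z ∧ dist w z < R') ∧ (-I * w).re < β} = gB := by
      ext w; simp [hgB]
    rwa [e] at this
  have hpT : IsPreconnected gT := by
    have := annulus_inter_halfPlane_preconnected z I (by simp) r' R' (-β') hr'0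
    have e : {w : ℂ | (r' < dist w z ∧ dist w z < R') ∧ (I * w).re < -β'} = gT := by
      ext w; simp [hgT]
    rwa [e] at this
  -- nonempty pieces are near `z`
  have hre_le : ∀ w : ℂ, |w.re - z.re| ≤ dist w z := fun w => by
    rw [Complex.dist_eq]; exact (abs_re_le_norm (w - z)).trans_eq' (by simp)
  have him_le : ∀ w : ℂ, |w.im - z.im| ≤ dist w z := fun w => by
    rw [Complex.dist_eq]; exact (abs_im_le_norm (w - z)).trans_eq' (by simp)
  have nL : gL.Nonempty → z.re - α < R' / 3 := by
    rintro ⟨w, ⟨-, h2⟩, h3⟩; have := abs_le.1 (hre_le w); exact hL (by linarith)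
  have nR : gR.Nonempty → α' - z.re < R' / 3 := by
    rintro ⟨w, ⟨-, h2⟩, h3⟩; have := abs_le.1 (hre_le w); exact hRt (by linarith)
  have nB : gB.Nonempty → z.im - β < R' / 3 := by
    rintro ⟨w, ⟨-, h2⟩, h3⟩; have := abs_le.1 (him_le w); exact hB (by linarith)
  have nT : gT.Nonempty → β' - z.im < R' / 3 := by
    rintro ⟨w, ⟨-, h2⟩, h3⟩; have := abs_le.1 (him_le w); exact hT (by linarith)
  -- the diagonal witnesses
  have hR'3 : 0 ≤ R' / 3 := by linarith
  have diag : ∀ (sre sim : ℝ), (sre = 1 ∨ sre = -1) → (sim = 1 ∨ sim = -1) →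
      z + (R' / 3 : ℝ) * (⟨sre, sim⟩ : ℂ) ∈ U ∧ (z + (R' / 3 : ℝ) * (⟨sre, sim⟩ : ℂ)).re = z.re + R' / 3 * sre ∧
        (z + (R' / 3 : ℝ) * (⟨sre, sim⟩ : ℂ)).im = z.im + R' / 3 * sim := by
    intro sre sim h1 h2
    obtain ⟨hd1, hd2⟩ := norm_diag_bounds_HTP ⟨sre, sim⟩ h1 h2
    refine ⟨diag_mem_annulus_HTP z _ hR'3 hd1 hd2 (by linarith) (by linarith), by simp, by simp⟩
  -- pairwise intersections
  have iLB : gL.Nonempty → gB.Nonempty → (gL ∩ gB).Nonempty := fun h1 h2 => by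
    obtain ⟨hU', hre, him⟩ := diag (-1) (-1) (Or.inr rfl) (Or.inr rfl)
    exact ⟨_, ⟨hU', by rw [hre]; linarith [nL h1]⟩, ⟨hU', by rw [him]; linarith [nB h2]⟩⟩
  have iLT : gL.Nonempty → gT.Nonempty → (gL ∩ gT).Nonempty := fun h1 h2 => by
    obtain ⟨hU', hre, him⟩ := diag (-1) 1 (Or.inr rfl) (Or.inl rfl)
    exact ⟨_, ⟨hU', by rw [hre]; linarith [nL h1]⟩, ⟨hU', by rw [him]; linarith [nT h2]⟩⟩
  have iRB : gR.Nonempty → gB.Nonempty → (gR ∩ gB).Nonempty := fun h1 h2 => by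
    obtain ⟨hU', hre, him⟩ := diag 1 (-1) (Or.inl rfl) (Or.inr rfl)
    exact ⟨_, ⟨hU', by rw [hre]; linarith [nR h1]⟩, ⟨hU', by rw [him]; linarith [nB h2]⟩⟩
  have iRT : gR.Nonempty → gT.Nonempty → (gR ∩ gT).Nonempty := fun h1 h2 => by
    obtain ⟨hU', hre, him⟩ := diag 1 1 (Or.inl rfl) (Or.inl rfl)
    exact ⟨_, ⟨hU', by rw [hre]; linarith [nR h1]⟩, ⟨hU', by rw [him]; linarith [nT h2]⟩⟩
  have nLR : gL.Nonempty → gR.Nonempty → False := fun h1 h2 => by linarith [nL h1, nR h2]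
  have nBT : gB.Nonempty → gT.Nonempty → False := fun h1 h2 => by linarith [nB h1, nT h2]
  -- assemble
  have e : {w : ℂ | (r' < dist w z ∧ dist w z < R') ∧ (w.re < α ∨ α' < w.re ∨ w.im < β ∨ β' < w.im)} =
      ((gL ∪ gB) ∪ gR) ∪ gT := by
    ext w
    simp only [mem_setOf_eq, mem_union, hgL, hgB, hgR, hgT]
    constructor
    · rintro ⟨hU', h | h | h | h⟩
      · exact Or.inl (Or.inl (Or.inl ⟨hU', h⟩))
      · exact Or.inl (Or.inr ⟨hU', h⟩)
      · exact Or.inl (Or.inl (Or.inr ⟨hU', h⟩))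
      · exact Or.inr ⟨hU', h⟩
    · rintro (((⟨hU', h⟩ | ⟨hU', h⟩) | ⟨hU', h⟩) | ⟨hU', h⟩)
      · exact ⟨hU', Or.inl h⟩
      · exact ⟨hU', Or.inr (Or.inr (Or.inl h))⟩
      · exact ⟨hU', Or.inr (Or.inl h)⟩
      · exact ⟨hU', Or.inr (Or.inr (Or.inr h))⟩
  rw [e]
  refine isPreconnected_union_of_HTP (fun h1 h2 => ?_)
    (isPreconnected_union_of_HTP (fun h1 h2 => ?_) (isPreconnected_union_of_HTP iLB hpL hpB) hpR) hpT
  · rcases h1 with ⟨w, (hw | hw) | hw⟩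
    · obtain ⟨x, hx1, hx2⟩ := iLT ⟨w, hw⟩ h2; exact ⟨x, Or.inl (Or.inl hx1), hx2⟩
    · exact absurd h2 (fun h => nBT ⟨w, hw⟩ h)
    · obtain ⟨x, hx1, hx2⟩ := iRT ⟨w, hw⟩ h2; exact ⟨x, Or.inr hx1, hx2⟩
  · rcases h1 with ⟨w, hw | hw⟩
    · exact absurd h2 (fun h => nLR ⟨w, hw⟩ h)
    · obtain ⟨x, hx1, hx2⟩ := iRB h2 ⟨w, hw⟩; exact ⟨x, Or.inr hx2, hx1⟩

/-- **The exterior of a rectangle inside an annulus is preconnected** (registered anchor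
`ufrs_annulusExteriorPreconnected` of stmt-CriticalPhenomena-11387; `annulus_exterior_preconnected`
with all binders explicit). -/
theorem ufrs_annulusExteriorPreconnected : ∀ (z : ℂ) (r R : ℝ) (a₀ a₁ b₀ b₁ : ℤ), 0 ≤ r → 3 * (r + 1 / 2) < R - 1 / 2 → 2 * (R - 1 / 2) ≤ ((a₁ : ℝ) - 1 / 8) - ((a₀ : ℝ) + 1 / 8) → 2 * (R - 1 / 2) ≤ ((b₁ : ℝ) - 1 / 8) - ((b₀ : ℝ) + 1 / 8) → (z.re - ((a₀ : ℝ) + 1 / 8) < R - 1 / 2 → z.re - ((a₀ : ℝ) + 1 / 8) < (R - 1 / 2) / 3) → (((a₁ : ℝ) - 1 / 8) - z.re < R - 1 / 2 → ((a₁ : ℝ) - 1 / 8) - z.re < (R - 1 / 2) / 3) → (z.im - ((b₀ : ℝ) + 1 / 8) < R - 1 / 2 → z.im - ((b₀ : ℝ) + 1 / 8) < (R - 1 / 2) / 3) → (((b₁ : ℝ) - 1 / 8) - z.im < R - 1 / 2 → ((b₁ : ℝ) - 1 / 8) - z.im < (R - 1 / 2) / 3) → IsPreconnected {w : ℂ |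 (r + 1 / 2 < dist w z ∧ dist w z < R - 1 / 2) ∧ (w.re < (a₀ : ℝ) + 1 / 8 ∨ (a₁ : ℝ) - 1 / 8 < w.re ∨ w.im < (b₀ : ℝ) + 1 / 8 ∨ (b₁ : ℝ) - 1 / 8 < w.im)} :=
  fun z r R a₀ a₁ b₀ b₁ hr h3 hW hH hL hRt hB hT => annulus_exterior_preconnected z r R a₀ a₁ b₀ b₁ hr h3 hW hH hL hRt hB hT

end

end Summit.CriticalPhenomena.CardyFormulaZ2.Cruxes.EdgePrecompact.QkzStripBoundaryArm
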